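import Summits.ResolutionOfSingularities.ResolutionOfSingularities.Theorems.EquisingularLiftEquisingularLiftNatSpecimenS10
import HarnessLib

/-!
# [OURS · L1 W4.5(b) · EL♮(3)] The WHOLE FAMILY `(x² + y²z)² + g`, `g` of `(2,1,2)`-weight `≥ 9`, is NOT locally Newton-nondegenerate in the
# design frame — one lemma for every «approximate-root» customer of S10's shape (S10, and the post-P⁶ candidates N4, N6 of res-L1-w45b-lead-1's
# POST-P6-CENSUS)

OURS · L1 W4.5(b) · crux `EquisingularLiftNatThree` stmt-ResolutionOfSingularities-20148 · counted 0 · AI-written (res-L1-w45b-lead-1 g16), weaker than expert review;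
nothing of [Hironaka2017] asserted; no statement of the manuscript; EL♮(3) NOT proved.  Sorry-free, standard axioms, def-free (the family is written out),
`--supports stmt-ResolutionOfSingularities-20148 --as helper`.  Bookkeeping REUSED from res-L1-w45b-iso-w3's `…NatSpecimenG3` (`eG3`, `wt_…`, `coeff_initialForm`)
and from `…NatSpecimenS10` (`weightS10 = (2,1,2)`, `coeff_sq_edgeS10`, `torusPointS10 = (1,1,−1)`, `eval_torusPointS10_edge`), not restated.

WHAT.  For ANY field `k` and ANY `g ∈ k[x,y,z]` all of whose monomials have weight `2a + b + 2c ≥ 9` (hypothesis `hg`, stated on coefficients), the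
polynomial `f = (x² + y²z)² + g` has `(2,1,2)`-initial form EXACTLY the square `(x² + y²z)²` (`initialForm_sqEdge_add`), hence fails Kouchnirenko's local
condition at the torus point `(1, 1, −1)` (`not_isLocallyNewtonNondegenerate_sqEdge_add`), hence `¬ LocalND`, `¬ LocalNDWon` — in the GIVEN coordinates (frame-bound,
honest scope as in `…NatSpecimenS10`).  Instances: `S10` (tail `x⁵ + z⁶ + xy⁸ + x¹⁰ + y¹⁰ + z¹⁰`, weights `10,12,10,20,10,20`) is re-derived from the family lemma;
**N4** `= (x²+y²z)² + x⁶ + z⁷ + xy⁹ + x¹¹ + y¹¹ + z¹¹` (weights `12,14,11,22,11,22`) and **N6** `= (x²+y²z)² + x⁵z + z⁷ + xy⁸ + x¹⁰ + y¹⁰ + z¹⁰` (weights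
`12,14,10,20,10,20`) — the first post-P⁶ residue CANDIDATES of the census (kit j317712: the R17 key-letter pair word leaves a non-constant section of `E_S`
hosted by no member) — get their frame-bound non-ND certificate here.  (Their all-frames status, isolatedness and legality census are by hand / kit, NOT here.)
-/

noncomputable section

set_option linter.dupNamespace false

open MvPolynomial

namespace Summit.ResolutionOfSingularities.ResolutionOfSingularities.Cruxes.EquisingularLiftNat.Sections

variable (k : Type) [Field k]

/-! ## The square edge `(x² + y²z)²` carries only weight-`8` monomials -/

/-- [OURS · L1 W4.5b] Every monomial of `(x² + y²z)²` with a nonzero coefficient has `(2,1,2)`-weight `8`. [folklore] -/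
theorem wt_eq_eight_of_coeff_sq_edge_ne_zero {d : Fin 3 →₀ ℕ}
    (hd : coeff d ((X 0 ^ 2 + X 1 ^ 2 * X 2) ^ 2 : MvPolynomial (Fin 3) k) ≠ 0) : wt weightS10 d = 8 := by
  rw [coeff_sq_edgeS10] at hd
  by_cases h1 : eG3 4 0 0 = d
  · rw [← h1, wt_weightS10_eG3]; norm_num
  by_cases h2 : eG3 2 2 1 = d
  · rw [← h2, wt_weightS10_eG3]; norm_num
  by_cases h3 : eG3 0 4 2 = d
  · rw [← h3, wt_weightS10_eG3]; norm_num
  simp [h1, h2, h3] at hd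

/-- [OURS · L1 W4.5b] Contrapositive: off weight `8` the square edge has coefficient `0`. [folklore] -/
theorem coeff_sq_edge_eq_zero_of_wt_ne {d : Fin 3 →₀ ℕ} (hd : wt weightS10 d ≠ 8) :
    coeff d ((X 0 ^ 2 + X 1 ^ 2 * X 2) ^ 2 : MvPolynomial (Fin 3) k) = 0 := by
  by_contra h
  exact hd (wt_eq_eight_of_coeff_sq_edge_ne_zero k h)

/-- [OURS · L1 W4.5b] The coefficient of `x⁴` in `(x² + y²z)²` is `1`. [folklore] -/
theorem coeff_eG3_400_sq_edge : coeff (eG3 4 0 0) ((X 0 ^ 2 + X 1 ^ 2 * X 2) ^ 2 : MvPolynomial (Fin 3) k) = 1 := by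
  rw [coeff_sq_edgeS10]
  have h2 : ¬ eG3 2 2 1 = eG3 4 0 0 := by rw [eG3_eq_iff]; omega
  have h3 : ¬ eG3 0 4 2 = eG3 4 0 0 := by rw [eG3_eq_iff]; omega
  simp [h2, h3]

/-! ## The family `(x² + y²z)² + g`, `g` of weight `≥ 9` -/

section Family

variable {k}
variable {g : MvPolynomial (Fin 3) k} (hg : ∀ d : Fin 3 →₀ ℕ, coeff d g ≠ 0 → 9 ≤ wt weightS10 d)
include hg

/-- [OURS · L1 W4.5b] `g` has no monomial of weight `≤ 8`. [folklore] -/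
theorem coeff_eq_zero_of_wt_le_eight {d : Fin 3 →₀ ℕ} (hd : wt weightS10 d ≤ 8) : coeff d g = 0 := by
  by_contra h
  have := hg d h
  omega

/-- [OURS · L1 W4.5b] Every monomial in the support of `(x² + y²z)² + g` has weight `≥ 8`. [folklore] -/
theorem le_wt_of_mem_support_sqEdge_add {d : Fin 3 →₀ ℕ}
    (hd : d ∈ ((X 0 ^ 2 + X 1 ^ 2 * X 2) ^ 2 + g : MvPolynomial (Fin 3) k).support) : 8 ≤ wt weightS10 d := by
  rw [mem_support_iff, coeff_add] at hd
  by_cases h1 : coeff d ((X 0 ^ 2 + X 1 ^ 2 * X 2) ^ 2 : MvPolynomial (Fin 3) k) = 0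
  · rw [h1, zero_add] at hd
    have := hg d hd
    omega
  · rw [wt_eq_eight_of_coeff_sq_edge_ne_zero k h1]

/-- [OURS · L1 W4.5b] `x⁴` is in the support of `(x² + y²z)² + g` (coefficient `1 + 0`). [folklore] -/
theorem eG3_400_mem_support_sqEdge_add : eG3 4 0 0 ∈ ((X 0 ^ 2 + X 1 ^ 2 * X 2) ^ 2 + g : MvPolynomial (Fin 3) k).support := by
  rw [mem_support_iff, coeff_add, coeff_eG3_400_sq_edge, coeff_eq_zero_of_wt_le_eight hg (by rw [wt_weightS10_eG3]; norm_num)]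
  norm_num

/-- [OURS · L1 W4.5b] The support of `(x² + y²z)² + g` is nonempty. [folklore] -/
theorem support_sqEdge_add_nonempty : ((X 0 ^ 2 + X 1 ^ 2 * X 2) ^ 2 + g : MvPolynomial (Fin 3) k).support.Nonempty :=
  ⟨_, eG3_400_mem_support_sqEdge_add hg⟩

/-- [OURS · L1 W4.5b] **The minimal `(2,1,2)`-weight on the support of `(x² + y²z)² + g` is `8`.** [folklore] -/
theorem inf_wt_sqEdge_add :
    ((X 0 ^ 2 + X 1 ^ 2 * X 2) ^ 2 + g : MvPolynomial (Fin 3) k).support.inf' (support_sqEdge_add_nonempty hg) (wt weightS10) = 8 := by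
  apply le_antisymm
  · refine (Finset.inf'_le _ (eG3_400_mem_support_sqEdge_add hg)).trans (le_of_eq ?_)
    rw [wt_weightS10_eG3]; norm_num
  · exact Finset.le_inf' _ _ fun d hd => le_wt_of_mem_support_sqEdge_add hg hd

/-- [OURS · L1 W4.5b] **The `(2,1,2)`-initial form of `(x² + y²z)² + g` is the square `(x² + y²z)²`**, for every `g` of weight `≥ 9`. [folklore] -/
theorem initialForm_sqEdge_add :
    initialForm weightS10 ((X 0 ^ 2 + X 1 ^ 2 * X 2) ^ 2 + g : MvPolynomial (Fin 3) k) = (X 0 ^ 2 + X 1 ^ 2 * X 2) ^ 2 := by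
  ext d
  rw [coeff_initialForm weightS10 _ (support_sqEdge_add_nonempty hg), inf_wt_sqEdge_add hg]
  by_cases h8 : wt weightS10 d = 8
  · rw [if_pos h8, coeff_add, coeff_eq_zero_of_wt_le_eight hg (le_of_eq h8), add_zero]
  · rw [if_neg h8, coeff_sq_edge_eq_zero_of_wt_ne k h8]

/-- [OURS · L1 W4.5b] **★ The family `(x² + y²z)² + g` (`g` of `(2,1,2)`-weight `≥ 9`) is NOT locally Newton-nondegenerate in the given coordinates,
over every field**: the positive weight `(2,1,2)` has initial form `(x² + y²z)²`, which vanishes with all its partial derivatives at the torus point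
`(1, 1, −1)`.  Frame-bound (one coordinate system), as `…NatSpecimenS10`. [folklore] -/
theorem not_isLocallyNewtonNondegenerate_sqEdge_add :
    ¬ IsLocallyNewtonNondegenerate ((X 0 ^ 2 + X 1 ^ 2 * X 2) ^ 2 + g : MvPolynomial (Fin 3) k) := by
  intro h
  have hw : ∀ i : Fin 3, 0 < weightS10 i := by
    intro i; fin_cases i <;> simp [weightS10]
  have hx : ∀ i : Fin 3, torusPointS10 (k := k) i ≠ 0 := by
    intro i; fin_cases i <;> simp [torusPointS10]
  refine h weightS10 hw torusPointS10 hx ?_ ?_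
  · rw [initialForm_sqEdge_add hg, map_pow, eval_torusPointS10_edge]
    norm_num
  · intro i
    rw [initialForm_sqEdge_add hg, sq, Derivation.leibniz, map_add, smul_eq_mul, map_mul, eval_torusPointS10_edge]
    simp

/-- [OURS · L1 W4.5b] Hence `¬ LocalND` for every member of the family (the ND lane's local datum fails as written). [folklore] -/
theorem not_localND_sqEdge_add : ¬ LocalND ((X 0 ^ 2 + X 1 ^ 2 * X 2) ^ 2 + g : MvPolynomial (Fin 3) k) :=
  fun h => not_isLocallyNewtonNondegenerate_sqEdge_add hg h.2

/-- [OURS · L1 W4.5b] … and `¬ LocalNDWon`. [folklore] -/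
theorem not_localNDWon_sqEdge_add : ¬ LocalNDWon ((X 0 ^ 2 + X 1 ^ 2 * X 2) ^ 2 + g : MvPolynomial (Fin 3) k) :=
  fun h => not_localND_sqEdge_add hg h.1

end Family

/-! ## Instances: the tails of S10, N4, N6 have weight ≥ 9 -/

/-- [OURS · L1 W4.5b] plumbing: a sum of six monomials with coefficient `1` has its coefficients supported on those six exponents. [folklore] -/
theorem coeff_six_monomials (e₁ e₂ e₃ e₄ e₅ e₆ d : Fin 3 →₀ ℕ) :
    coeff d (monomial e₁ (1 : k) + monomial e₂ 1 + monomial e₃ 1 + monomial e₄ 1 + monomial e₅ 1 + monomial e₆ 1) =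
      (if e₁ = d then 1 else 0) + (if e₂ = d then 1 else 0) + (if e₃ = d then 1 else 0) + (if e₄ = d then 1 else 0) +
        (if e₅ = d then 1 else 0) + (if e₆ = d then 1 else 0) := by
  simp only [coeff_add, coeff_monomial]

/-- [OURS · L1 W4.5b] plumbing: if six exponents all have weight `≥ 9`, the six-monomial sum satisfies the family hypothesis `hg`. [folklore] -/
theorem nine_le_wt_of_coeff_six_monomials_ne_zero {e₁ e₂ e₃ e₄ e₅ e₆ : Fin 3 →₀ ℕ}
    (h₁ : 9 ≤ wt weightS10 e₁) (h₂ : 9 ≤ wt weightS10 e₂) (h₃ : 9 ≤ wt weightS10 e₃) (h₄ : 9 ≤ wt weightS10 e₄)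
    (h₅ : 9 ≤ wt weightS10 e₅) (h₆ : 9 ≤ wt weightS10 e₆) (d : Fin 3 →₀ ℕ)
    (hd : coeff d (monomial e₁ (1 : k) + monomial e₂ 1 + monomial e₃ 1 + monomial e₄ 1 + monomial e₅ 1 + monomial e₆ 1) ≠ 0) :
    9 ≤ wt weightS10 d := by
  rw [coeff_six_monomials] at hd
  by_cases c₁ : e₁ = d
  · rw [← c₁]; exact h₁
  by_cases c₂ : e₂ = d
  · rw [← c₂]; exact h₂
  by_cases c₃ : e₃ = d
  · rw [← c₃]; exact h₃
  by_cases c₄ : e₄ = d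
  · rw [← c₄]; exact h₄
  by_cases c₅ : e₅ = d
  · rw [← c₅]; exact h₅
  by_cases c₆ : e₆ = d
  · rw [← c₆]; exact h₆
  simp [c₁, c₂, c₃, c₄, c₅, c₆] at hd

/-- [OURS · L1 W4.5b] S10's tail as six monomials. [folklore] -/
theorem tailS10_eq : (X 0 ^ 5 + X 2 ^ 6 + X 0 * X 1 ^ 8 + X 0 ^ 10 + X 1 ^ 10 + X 2 ^ 10 : MvPolynomial (Fin 3) k) =
    monomial (eG3 5 0 0) 1 + monomial (eG3 0 0 6) 1 + monomial (eG3 1 8 0) 1 + monomial (eG3 10 0 0) 1 + monomial (eG3 0 10 0) 1 +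
      monomial (eG3 0 0 10) 1 := by
  simp only [monomial_eG3, map_one, one_mul, pow_zero, mul_one, pow_one]

/-- [OURS · L1 W4.5b] N4's tail as six monomials. [folklore] -/
theorem tailN4_eq : (X 0 ^ 6 + X 2 ^ 7 + X 0 * X 1 ^ 9 + X 0 ^ 11 + X 1 ^ 11 + X 2 ^ 11 : MvPolynomial (Fin 3) k) =
    monomial (eG3 6 0 0) 1 + monomial (eG3 0 0 7) 1 + monomial (eG3 1 9 0) 1 + monomial (eG3 11 0 0) 1 + monomial (eG3 0 11 0) 1 +
      monomial (eG3 0 0 11) 1 := by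
  simp only [monomial_eG3, map_one, one_mul, pow_zero, mul_one, pow_one]

/-- [OURS · L1 W4.5b] N6's tail as six monomials. [folklore] -/
theorem tailN6_eq : (X 0 ^ 5 * X 2 + X 2 ^ 7 + X 0 * X 1 ^ 8 + X 0 ^ 10 + X 1 ^ 10 + X 2 ^ 10 : MvPolynomial (Fin 3) k) =
    monomial (eG3 5 0 1) 1 + monomial (eG3 0 0 7) 1 + monomial (eG3 1 8 0) 1 + monomial (eG3 10 0 0) 1 + monomial (eG3 0 10 0) 1 +
      monomial (eG3 0 0 10) 1 := by
  simp only [monomial_eG3, map_one, one_mul, pow_zero, mul_one, pow_one]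

/-- [OURS · L1 W4.5b] S10's tail has weight `≥ 9` (`10, 12, 10, 20, 10, 20`). [folklore] -/
theorem hg_tailS10 (d : Fin 3 →₀ ℕ)
    (hd : coeff d (X 0 ^ 5 + X 2 ^ 6 + X 0 * X 1 ^ 8 + X 0 ^ 10 + X 1 ^ 10 + X 2 ^ 10 : MvPolynomial (Fin 3) k) ≠ 0) : 9 ≤ wt weightS10 d := by
  rw [tailS10_eq] at hd
  exact nine_le_wt_of_coeff_six_monomials_ne_zero k (by rw [wt_weightS10_eG3]; norm_num) (by rw [wt_weightS10_eG3]; norm_num)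
    (by rw [wt_weightS10_eG3]; norm_num) (by rw [wt_weightS10_eG3]; norm_num) (by rw [wt_weightS10_eG3]; norm_num)
    (by rw [wt_weightS10_eG3]; norm_num) d hd

/-- [OURS · L1 W4.5b] N4's tail has weight `≥ 9` (`12, 14, 11, 22, 11, 22`). [folklore] -/
theorem hg_tailN4 (d : Fin 3 →₀ ℕ)
    (hd : coeff d (X 0 ^ 6 + X 2 ^ 7 + X 0 * X 1 ^ 9 + X 0 ^ 11 + X 1 ^ 11 + X 2 ^ 11 : MvPolynomial (Fin 3) k) ≠ 0) : 9 ≤ wt weightS10 d := by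
  rw [tailN4_eq] at hd
  exact nine_le_wt_of_coeff_six_monomials_ne_zero k (by rw [wt_weightS10_eG3]; norm_num) (by rw [wt_weightS10_eG3]; norm_num)
    (by rw [wt_weightS10_eG3]; norm_num) (by rw [wt_weightS10_eG3]; norm_num) (by rw [wt_weightS10_eG3]; norm_num)
    (by rw [wt_weightS10_eG3]; norm_num) d hd

/-- [OURS · L1 W4.5b] N6's tail has weight `≥ 9` (`12, 14, 10, 20, 10, 20`). [folklore] -/
theorem hg_tailN6 (d : Fin 3 →₀ ℕ)
    (hd : coeff d (X 0 ^ 5 * X 2 + X 2 ^ 7 + X 0 * X 1 ^ 8 + X 0 ^ 10 + X 1 ^ 10 + X 2 ^ 10 : MvPolynomial (Fin 3) k) ≠ 0) :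
    9 ≤ wt weightS10 d := by
  rw [tailN6_eq] at hd
  exact nine_le_wt_of_coeff_six_monomials_ne_zero k (by rw [wt_weightS10_eG3]; norm_num) (by rw [wt_weightS10_eG3]; norm_num)
    (by rw [wt_weightS10_eG3]; norm_num) (by rw [wt_weightS10_eG3]; norm_num) (by rw [wt_weightS10_eG3]; norm_num)
    (by rw [wt_weightS10_eG3]; norm_num) d hd

/-- [OURS · L1 W4.5b] Consistency check: S10 = edge square + its tail, so `…NatSpecimenS10`'s certificate is the family lemma's first instance. [folklore] -/
theorem specimenS10_eq_sqEdge_add_tail :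
    specimenS10 k = (X 0 ^ 2 + X 1 ^ 2 * X 2) ^ 2 + (X 0 ^ 5 + X 2 ^ 6 + X 0 * X 1 ^ 8 + X 0 ^ 10 + X 1 ^ 10 + X 2 ^ 10) := by
  simp only [specimenS10]; ring

/-- [OURS · L1 W4.5b] **N4 = `(x²+y²z)² + x⁶ + z⁷ + xy⁹ + x¹¹ + y¹¹ + z¹¹` is NOT locally Newton-nondegenerate in the given coordinates** (post-P⁶ residue
candidate of res-L1-w45b-lead-1's POST-P6-CENSUS; frame-bound certificate). [OURS · L1 W4.5b · specimen] -/
theorem not_isLocallyNewtonNondegenerate_N4 :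
    ¬ IsLocallyNewtonNondegenerate
      ((X 0 ^ 2 + X 1 ^ 2 * X 2) ^ 2 + (X 0 ^ 6 + X 2 ^ 7 + X 0 * X 1 ^ 9 + X 0 ^ 11 + X 1 ^ 11 + X 2 ^ 11) : MvPolynomial (Fin 3) k) :=
  not_isLocallyNewtonNondegenerate_sqEdge_add (hg_tailN4 k)

/-- [OURS · L1 W4.5b] **N6 = `(x²+y²z)² + x⁵z + z⁷ + xy⁸ + x¹⁰ + y¹⁰ + z¹⁰` is NOT locally Newton-nondegenerate in the given coordinates.**
[OURS · L1 W4.5b · specimen] -/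
theorem not_isLocallyNewtonNondegenerate_N6 :
    ¬ IsLocallyNewtonNondegenerate
      ((X 0 ^ 2 + X 1 ^ 2 * X 2) ^ 2 + (X 0 ^ 5 * X 2 + X 2 ^ 7 + X 0 * X 1 ^ 8 + X 0 ^ 10 + X 1 ^ 10 + X 2 ^ 10) : MvPolynomial (Fin 3) k) :=
  not_isLocallyNewtonNondegenerate_sqEdge_add (hg_tailN6 k)

/-- [OURS · L1 W4.5b] `¬ LocalNDWon` for N4. [OURS · L1 W4.5b · specimen] -/
theorem not_localNDWon_N4 :
    ¬ LocalNDWon ((X 0 ^ 2 + X 1 ^ 2 * X 2) ^ 2 + (X 0 ^ 6 + X 2 ^ 7 + X 0 * X 1 ^ 9 + X 0 ^ 11 + X 1 ^ 11 + X 2 ^ 11) : MvPolynomial (Fin 3) k) :=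
  not_localNDWon_sqEdge_add (hg_tailN4 k)

/-- [OURS · L1 W4.5b] `¬ LocalNDWon` for N6. [OURS · L1 W4.5b · specimen] -/
theorem not_localNDWon_N6 :
    ¬ LocalNDWon ((X 0 ^ 2 + X 1 ^ 2 * X 2) ^ 2 + (X 0 ^ 5 * X 2 + X 2 ^ 7 + X 0 * X 1 ^ 8 + X 0 ^ 10 + X 1 ^ 10 + X 2 ^ 10) : MvPolynomial (Fin 3) k) :=
  not_localNDWon_sqEdge_add (hg_tailN6 k)

end Summit.ResolutionOfSingularities.ResolutionOfSingularities.Cruxes.EquisingularLiftNat.Sections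

end
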